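import Summits.ResolutionOfSingularities.ResolutionOfSingularities.Theorems.FrobeniusLadderFInjectiveMacaulayficationFanCheckSound
import Summits.ResolutionOfSingularities.ResolutionOfSingularities.Theorems.FrobeniusLadderFInjectiveMacaulayficationQ6CNKit
import Summits.ResolutionOfSingularities.ResolutionOfSingularities.Theorems.FrobeniusLadderFInjectiveMacaulayficationMonomialCoverRecord
import Mathlib.LinearAlgebra.Matrix.NonsingularInverse
import Mathlib.RingTheory.Ideal.Quotient.Defs
import HarnessLib

/-!
# Soundness of the fan-check kit, II: the fan-side binders of `pointFixable_of_ciCert` from ONE `decide` each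
# (crux `FInjectiveMacaulayfication`, road B, U12)

[OURS · L1 W4.5a] Support file for crux stmt-ResolutionOfSingularities-15315 (res-L1-w45a-plan-1 R12.33 (c), seat res-L1-w45a-stub-4).
For the data of a road-B toric certificate in the currency of `FanCheckKit` — generators `AL2` (two-level), rays `RAYS`, chart records
`CL`, integer inverse columns `VinvTL`, multipliers `NuL`, cover records `RL`, pure-power index pairs `PJ` — and with
`A := genSet n AL2`, `V := chartV n RAYS CL t`, `m := chartM n AL2 CL t`, `a := chartA n AL2 CL t`, `d := chartD n r CL t`
(`ht : CL.length = t`), each Boolean check of the kit yields the corresponding binder of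
`PointFixableOfCert.pointFixable_of_ciCert` / `CICertificates.ciCertificates` VERBATIM:

* §C/§D what `checkShapes` says; `genSet` membership; `mulVec_rayMat` (`V c · v` in list currency);
* §E `hm_of_shapes`, `haA_of_shapes`, `hv_of_shapes` (index bounds only), `hgen_of_check` (via `Q6CNKit.hgen_of_vec`),
  `hge_of_check` (the vertex property, via the ray-wise `max ≤ min` check);
* §F `hcov_of_check` (via U2 `MonomialCoverRecord.hcov_of_record`), `hV_of_check` (unimodularity via
  `Matrix.isUnit_det_of_right_inverse`), `hunit_of_check`, `hprim_of_check`, `hAJ_of_check`.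

USE (T⁽⁴⁾/7 fan side, measured end to end: all nine binders as theorems of ONE 288 KB file in 145 s, default heartbeats):
`theorem hge : <binder> := FanCheckSound.hge_of_check 5 1 AL2 RAYS CL 537 (by decide +kernel) (by decide +kernel) (by decide +kernel)`.
No definitions, no named facts. AI-written, weaker than expert review; no statement of [claim: Hironaka2017] is used. [folklore]
-/

-- single-problem summit: the doubled namespace component is forced
set_option linter.dupNamespace false

namespace Summit.ResolutionOfSingularities.ResolutionOfSingularities.Theorems.FInjectiveMacaulayfication.FanCheckSound

open Summit.ResolutionOfSingularities.ResolutionOfSingularities.Theorems.FInjectiveMacaulayfication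
open FanCheckKit

/-! ## §C What `checkShapes` says -/

section Shapes

variable {n r : ℕ} {AL2 : List (List (List ℕ))} {RAYS : List (List ℕ)}
  {CL : List (List ℕ × (ℕ × ℕ) × List (ℕ × ℕ) × List (List ℕ))}

/-- `allLen n L`: every member has length `n`. [folklore] -/
theorem allLen_spec {L : List (List ℕ)} (h : allLen n L = true) : ∀ l ∈ L, l.length = n := by
  intro l hl
  simp only [allLen, List.all_eq_true, Nat.beq_eq] at h
  exact h l hl

/-- `inRange2`: both components of the index pair are in range. [folklore] -/
theorem inRange2_spec {ip : ℕ × ℕ} (h : inRange2 AL2 ip = true) : ip.1 < AL2.length ∧ ip.2 < (getL AL2 ip.1 []).length := by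
  simp only [inRange2, Bool.and_eq_true, Nat.blt_eq] at h
  exact h

/-- An in-range index pair addresses a member of `AL2.flatten`. [folklore] -/
theorem get2_mem_flatten {ip : ℕ × ℕ} (h : inRange2 AL2 ip = true) : get2 AL2 ip ∈ AL2.flatten := by
  obtain ⟨h1, h2⟩ := inRange2_spec h
  exact List.mem_flatten.mpr ⟨getL AL2 ip.1 [], getL_mem _ _ _ h1, getL_mem _ _ _ h2⟩

/-- The generator chunks: every generator has length `n`. [folklore] -/
theorem shapes_AL2 (hsh : checkShapes n r AL2 RAYS CL = true) : ∀ l ∈ AL2.flatten, l.length = n := by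
  intro l hl
  simp only [checkShapes, Bool.and_eq_true, List.all_eq_true] at hsh
  obtain ⟨ch, hch, hlch⟩ := List.mem_flatten.mp hl
  exact allLen_spec (hsh.1.1 ch hch) l hlch

/-- Every ray has length `n`. [folklore] -/
theorem shapes_RAYS (hsh : checkShapes n r AL2 RAYS CL = true) : ∀ v ∈ RAYS, v.length = n := by
  simp only [checkShapes, Bool.and_eq_true, List.all_eq_true] at hsh
  exact allLen_spec hsh.1.2

/-- The shape of one chart record. [folklore] -/
theorem shapes_chart (hsh : checkShapes n r AL2 RAYS CL = true) {ch : List ℕ × (ℕ × ℕ) × List (ℕ × ℕ) × List (List ℕ)}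
    (hch : ch ∈ CL) :
    ch.1.length = n ∧ (∀ j ∈ ch.1, j < RAYS.length) ∧ inRange2 AL2 ch.2.1 = true ∧ ch.2.2.1.length = n ∧
      (∀ k ∈ ch.2.2.1, inRange2 AL2 k = true) ∧ ch.2.2.2.length = r ∧ ∀ l ∈ ch.2.2.2, l.length = n := by
  simp only [checkShapes, Bool.and_eq_true, List.all_eq_true] at hsh
  have h := hsh.2 ch hch
  simp only [Nat.beq_eq, Nat.blt_eq] at h
  obtain ⟨⟨⟨⟨⟨⟨h1, h2⟩, h3⟩, h4⟩, h5⟩, h6⟩, h7⟩ := h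
  exact ⟨h1, h2, h3, h4, h5, h6, allLen_spec h7⟩

/-- An in-range generator has length `n`. [folklore] -/
theorem length_get2 (hsh : checkShapes n r AL2 RAYS CL = true) {ip : ℕ × ℕ} (h : inRange2 AL2 ip = true) :
    (get2 AL2 ip).length = n :=
  shapes_AL2 hsh _ (get2_mem_flatten h)

/-- The `c`-th chart record is a member of the chart list. [folklore] -/
theorem chartRec_mem {t : ℕ} (ht : CL.length = t) (c : Fin t) : chartRec CL c.1 ∈ CL :=
  getL_mem _ _ _ (by rw [ht]; exact c.2)

end Shapes

/-! ## §D The generator set and the accessors -/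

section Accessors

variable {n : ℕ} {AL2 : List (List (List ℕ))}

/-- The function underlying `expOf n l` is `vecOf n l`. [folklore] -/
theorem coe_expOf (l : List ℕ) : ⇑(expOf n l) = vecOf n l := Finsupp.coe_equivFunOnFinite_symm _

/-- Generators give elements of `genSet`. [folklore] -/
theorem expOf_mem_genSet {l : List ℕ} (hl : l ∈ AL2.flatten) : expOf n l ∈ genSet n AL2 := by
  rw [genSet, List.mem_toFinset, List.mem_map]
  exact ⟨l, hl, rfl⟩

/-- Elements of `genSet` come from generators. [folklore] -/
theorem exists_of_mem_genSet {e : Fin n →₀ ℕ} (he : e ∈ genSet n AL2) : ∃ l ∈ AL2.flatten, e = expOf n l := by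
  rw [genSet, List.mem_toFinset, List.mem_map] at he
  obtain ⟨l, hl, rfl⟩ := he
  exact ⟨l, hl, rfl⟩

/-- **`V · v` in list currency**: the `i`-th entry of `rayMat n RAYS idx · v` is the `dotL` of the `i`-th row with `v`. [folklore] -/
theorem mulVec_rayMat (RAYS : List (List ℕ)) (idx : List ℕ) (v : List ℕ) (hv : v.length = n)
    (hR : ∀ w ∈ RAYS, w.length = n) (hidx : ∀ j ∈ idx, j < RAYS.length) (i : Fin n) (hi : i.1 < idx.length) :
    (rayMat n RAYS idx).mulVec (vecOf n v) i = dotL (getL RAYS (getL idx i.1 0) []) v := by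
  rw [dotL_eq_sum n _ _ (hR _ (getL_mem _ _ _ (hidx _ (getL_mem _ _ _ hi)))) hv]
  rfl

end Accessors

/-! ## §E The binders of `pointFixable_of_ciCert` from the checks -/

section Binders

variable (n r : ℕ) (AL2 : List (List (List ℕ))) (RAYS : List (List ℕ))
  (CL : List (List ℕ × (ℕ × ℕ) × List (ℕ × ℕ) × List (List ℕ))) (t : ℕ)

/-- **(hm)** every vertex is a generator — from the shapes alone. [folklore] -/
theorem hm_of_shapes (hsh : checkShapes n r AL2 RAYS CL = true) (ht : CL.length = t) :
    ∀ c : Fin t, chartM n AL2 CL t c ∈ genSet n AL2 := by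
  intro c
  obtain ⟨-, -, hm, -⟩ := shapes_chart hsh (chartRec_mem ht c)
  exact expOf_mem_genSet (get2_mem_flatten hm)

/-- **(haA)** every neighbour is a generator — from the shapes alone. [folklore] -/
theorem haA_of_shapes (hsh : checkShapes n r AL2 RAYS CL = true) (ht : CL.length = t) :
    ∀ (c : Fin t) (i : Fin n), chartA n AL2 CL t c i ∈ genSet n AL2 := by
  intro c i
  obtain ⟨-, -, -, hlen, ha, -⟩ := shapes_chart hsh (chartRec_mem ht c)
  exact expOf_mem_genSet (get2_mem_flatten (ha _ (getL_mem _ _ _ (by rw [hlen]; exact i.2))))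

/-- **(hv)** the vertex monomials lie in the centre — from `hm`. [folklore] -/
theorem hv_of_shapes {k : Type} [CommRing k] (hsh : checkShapes n r AL2 RAYS CL = true) (ht : CL.length = t) {r' : ℕ}
    (Fs : Fin r' → MvPolynomial (Fin n) k) (c : Fin t) :
    Ideal.Quotient.mk (Ideal.span (Set.range Fs)) (MvPolynomial.monomial (chartM n AL2 CL t c) (1 : k)) ∈
      Ideal.span ((fun e : Fin n →₀ ℕ => Ideal.Quotient.mk (Ideal.span (Set.range Fs)) (MvPolynomial.monomial e (1 : k))) ''
        (genSet n AL2 : Set (Fin n →₀ ℕ))) :=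
  Ideal.subset_span ⟨_, Finset.mem_coe.mpr (hm_of_shapes n r AL2 RAYS CL t hsh ht c), rfl⟩

/-- **(hgen)** `V c · a c i = V c · m c + e_i`. [folklore] -/
theorem hgen_of_check (hsh : checkShapes n r AL2 RAYS CL = true) (ht : CL.length = t) (h : checkHgen n AL2 RAYS CL = true) :
    ∀ (c : Fin t) (i : Fin n),
      (Finsupp.equivFunOnFinite.symm ((chartV n RAYS CL t c).mulVec ⇑(chartA n AL2 CL t c i)) : Fin n →₀ ℕ) =
        Finsupp.equivFunOnFinite.symm ((chartV n RAYS CL t c).mulVec ⇑(chartM n AL2 CL t c)) + Finsupp.single i 1 := by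
  intro c i
  have hch := chartRec_mem ht c
  obtain ⟨h1, hj, hm, hlen, ha, -, -⟩ := shapes_chart hsh hch
  have hc := List.all_eq_true.mp h _ hch
  rw [forceLL_eq, forceL_eq, hgenChart, List.all_eq_true] at hc
  have hik := hc _ (mk_getL_mem_range_zip n (chartRec CL c.1).2.2.1 (0, 0) i.1 i.2 (by rw [hlen]; exact i.2))
  have hEq := eq_of_veqL _ _ hik
  have hrlen : (raysOf RAYS (chartRec CL c.1).1).length = n := by rw [length_raysOf, h1]
  have hal : (get2 AL2 (getL (chartRec CL c.1).2.2.1 i.1 (0, 0))).length = n :=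
    length_get2 hsh (ha _ (getL_mem _ _ _ (by rw [hlen]; exact i.2)))
  have hml : (get2 AL2 (chartRec CL c.1).2.1).length = n := length_get2 hsh hm
  refine Q6CNKit.hgen_of_vec (chartV n RAYS CL t c) (vecOf n (get2 AL2 (getL (chartRec CL c.1).2.2.1 i.1 (0, 0))))
    (vecOf n (get2 AL2 (chartRec CL c.1).2.1)) i ?_
  funext j
  have hjlt : j.1 < (chartRec CL c.1).1.length := by rw [h1]; exact j.2
  rw [Pi.add_apply, Pi.single_apply, chartV, mulVec_rayMat RAYS _ _ hal (shapes_RAYS hsh) hj j hjlt,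
    mulVec_rayMat RAYS _ _ hml (shapes_RAYS hsh) hj j hjlt, ← getL_raysOf RAYS _ j.1 hjlt,
    ← getL_mulVecL _ _ j.1 (by rw [hrlen]; exact j.2), hEq,
    getL_addUnitL _ _ _ (by rw [length_mulVecL, hrlen]; exact j.2), getL_mulVecL _ _ j.1 (by rw [hrlen]; exact j.2)]
  by_cases hji : j = i
  · subst hji
    simp
  · have hne : j.1 ≠ i.1 := fun e => hji (Fin.ext e)
    simp [hji, hne]

/-- **(hge)** the vertex property `V c · m c ≤ V c · e` for all generators `e`. [folklore] -/
theorem hge_of_check (hsh : checkShapes n r AL2 RAYS CL = true) (ht : CL.length = t) (h : checkHge AL2 RAYS CL = true) :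
    ∀ (c : Fin t), ∀ e ∈ genSet n AL2,
      (Finsupp.equivFunOnFinite.symm ((chartV n RAYS CL t c).mulVec ⇑(chartM n AL2 CL t c)) : Fin n →₀ ℕ) ≤
        Finsupp.equivFunOnFinite.symm ((chartV n RAYS CL t c).mulVec ⇑e) := by
  intro c e he
  obtain ⟨el, hel, rfl⟩ := exists_of_mem_genSet he
  have hch := chartRec_mem ht c
  obtain ⟨h1, hj, hm, -, -, -, -⟩ := shapes_chart hsh hch
  intro j
  have hjlt : j.1 < (chartRec CL c.1).1.length := by rw [h1]; exact j.2
  have hrj : getL (chartRec CL c.1).1 j.1 0 < RAYS.length := hj _ (getL_mem _ _ _ hjlt)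
  rw [Finsupp.coe_equivFunOnFinite_symm, Finsupp.coe_equivFunOnFinite_symm, chartM, coe_expOf, coe_expOf, chartV,
    mulVec_rayMat RAYS _ _ (length_get2 hsh hm) (shapes_RAYS hsh) hj j hjlt,
    mulVec_rayMat RAYS _ _ (shapes_AL2 hsh el hel) (shapes_RAYS hsh) hj j hjlt]
  have hspec := checkHgeFrom_spec AL2 CL 0 RAYS h _ hrj
  rw [Nat.zero_add] at hspec
  have hany : ((chartRec CL c.1).1.any fun j' => Nat.beq j' (getL (chartRec CL c.1).1 j.1 0)) = true :=
    List.any_eq_true.mpr ⟨_, getL_mem _ _ _ hjlt, Nat.beq_refl _⟩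
  exact le_trans (le_maxDotRows AL2 _ _ CL _ hch hany) (le_trans hspec (minDotL2_le _ _ _ hel))

end Binders

/-! ## §F The remaining binders: cover records, unimodularity, (hunit), (hprim), (hAJ) -/

section Binders2

variable (n r : ℕ) (AL2 : List (List (List ℕ))) (RAYS : List (List ℕ))
  (CL : List (List ℕ × (ℕ × ℕ) × List (ℕ × ℕ) × List (List ℕ))) (t : ℕ)

/-- **(hcov)** the cover identities `(x^a)^K = x^(m c) · y`, `y ∈ I_A^(K-1)`, from the records (U2 `MonomialCoverRecord`). [folklore] -/
theorem hcov_of_check (k : Type) [CommSemiring k] (RL : List (ℕ × ℕ × (ℕ × ℕ) × List ℕ))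
    (hsh : checkShapes n r AL2 RAYS CL = true) (ht : CL.length = t) (h : checkHcov n AL2 CL t RL = true) :
    ∀ a ∈ genSet n AL2, ∃ (c : Fin t) (K : ℕ), 1 ≤ K ∧
      ∃ y ∈ (Ideal.span ((fun b : Fin n →₀ ℕ => (MvPolynomial.monomial b (1 : k) : MvPolynomial (Fin n) k)) ''
          (genSet n AL2 : Set (Fin n →₀ ℕ)))) ^ (K - 1),
        (MvPolynomial.monomial a (1 : k) : MvPolynomial (Fin n) k) ^ K = MvPolynomial.monomial (chartM n AL2 CL t c) 1 * y := by
  intro a ha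
  obtain ⟨al, hal, rfl⟩ := exists_of_mem_genSet ha
  obtain ⟨p, hp, hpal⟩ := exists_getL_eq_of_mem AL2.flatten [] hal
  simp only [checkHcov, Bool.and_eq_true, Nat.beq_eq, List.all_eq_true] at h
  obtain ⟨hlenRL, hall⟩ := h
  have hmem := mk_getL_mem_zip AL2.flatten RL [] (0, 0, (0, 0), []) p hp (by rw [← hlenRL]; exact hp)
  rw [hpal] at hmem
  have hrec := hall _ hmem
  simp only [Nat.blt_eq, Nat.ble_eq] at hrec
  obtain ⟨⟨⟨⟨hc, hK⟩, hb⟩, hrlen⟩, hveq⟩ := hrec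
  have hEq := eq_of_veqL _ _ hveq
  set rc := getL RL p (0, 0, (0, 0), []) with hrc_def
  have hml : (get2 AL2 (chartRec CL rc.1).2.1).length = n := by
    obtain ⟨-, -, hm, -⟩ := shapes_chart hsh (chartRec_mem ht ⟨rc.1, hc⟩)
    exact length_get2 hsh hm
  have hbl : (get2 AL2 rc.2.2.1).length = n := length_get2 hsh hb
  have hall' : al.length = n := shapes_AL2 hsh al hal
  refine MonomialCoverRecord.hcov_of_record k (genSet n AL2) (chartM n AL2 CL t) (expOf n al) ⟨rc.1, hc⟩ rc.2.1 hK
    (expOf n (get2 AL2 rc.2.2.1)) (expOf n rc.2.2.2) (expOf_mem_genSet (get2_mem_flatten hb)) ?_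
  ext j
  have hj : getL (smulL rc.2.1 al) j.1 0 = getL (addL (addL (get2 AL2 (chartRec CL rc.1).2.1)
      (smulL (rc.2.1 - 1) (get2 AL2 rc.2.2.1))) rc.2.2.2) j.1 0 := by rw [hEq]
  have hsl : (smulL (rc.2.1 - 1) (get2 AL2 rc.2.2.1)).length = n := by rw [smulL, List.length_map, hbl]
  rw [getL_smulL, getL_addL _ _ (by rw [length_addL_eq_min, hml, hsl, min_self, hrlen]),
    getL_addL _ _ (by rw [hml, hsl]), getL_smulL] at hj
  simp only [Finsupp.smul_apply, Finsupp.add_apply, smul_eq_mul, chartM, coe_expOf, vecOf]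
  exact hj

/-- **(hV)** unimodularity of every `V c`, from the integer inverse columns. [folklore] -/
theorem hV_of_check (VinvTL : List (List (List ℤ))) (hsh : checkShapes n r AL2 RAYS CL = true) (ht : CL.length = t)
    (h : checkDetUnit n RAYS CL VinvTL = true) :
    ∀ c : Fin t, IsUnit (((chartV n RAYS CL t c).map (Nat.cast : ℕ → ℤ)).det) := by
  intro c
  have hch := chartRec_mem ht c
  obtain ⟨h1, hj, -, -, -, -, -⟩ := shapes_chart hsh hch
  simp only [checkDetUnit, Bool.and_eq_true, Nat.beq_eq, List.all_eq_true] at h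
  obtain ⟨hlenV, hall⟩ := h
  have hmem := mk_getL_mem_zip CL VinvTL ([], (0, 0), [], []) [] c.1 (by rw [ht]; exact c.2) (by rw [← hlenV, ht]; exact c.2)
  change (chartRec CL c.1, getL VinvTL c.1 []) ∈ CL.zip VinvTL at hmem
  have hc := hall _ hmem
  dsimp only at hc
  obtain ⟨⟨hclen, hcols⟩, hcells⟩ := hc
  rw [forceLL_eq, List.all_eq_true] at hcells
  set cols := getL VinvTL c.1 [] with hcols_def
  -- the right inverse
  let W : Matrix (Fin n) (Fin n) ℤ := fun l j => vecOfZ n (getL cols j.1 []) l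
  refine Matrix.isUnit_det_of_right_inverse (B := W) ?_
  ext i j
  have hilt : i.1 < (chartRec CL c.1).1.length := by rw [h1]; exact i.2
  have hrow := hcells _ (mk_getL_mem_range_zip n (raysOf RAYS (chartRec CL c.1).1) [] i.1 i.2 (by rw [length_raysOf, h1]; exact i.2))
  rw [List.all_eq_true] at hrow
  have hcell := hrow _ (mk_getL_mem_range_zip n cols [] j.1 j.2 (by rw [hclen]; exact j.2))
  simp only [beq_iff_eq] at hcell
  rw [getL_raysOf RAYS _ i.1 hilt,
    dotZL_eq_sum n _ _ (shapes_RAYS hsh _ (getL_mem _ _ _ (hj _ (getL_mem _ _ _ hilt)))) (hcols _ (getL_mem _ _ _ (by rw [hclen]; exact j.2)))]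
    at hcell
  rw [Matrix.mul_apply, Matrix.one_apply]
  have hsum : (∑ l : Fin n, ((chartV n RAYS CL t c).map (Nat.cast : ℕ → ℤ)) i l * W l j) =
      ∑ l : Fin n, ((vecOf n (getL RAYS (getL (chartRec CL c.1).1 i.1 0) []) l : ℕ) : ℤ) * vecOfZ n (getL cols j.1 []) l := by
    refine Finset.sum_congr rfl fun l _ => ?_
    rfl
  rw [hsum, hcell]
  cases hij : Nat.beq i.1 j.1
  · rw [cond_false, if_neg (fun e => Nat.ne_of_beq_eq_false hij (congrArg Fin.val e))]
  · rw [cond_true, if_pos (Fin.ext (Nat.eq_of_beq_eq_true hij))]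

/-- **(hunit)** `N • m c = Σ_j (d c l)_j • a c j + r'` for some `N`, `r'`. [folklore] -/
theorem hunit_of_check (NuL : List (List ℕ)) (hsh : checkShapes n r AL2 RAYS CL = true) (ht : CL.length = t)
    (h : checkHunit n r AL2 CL NuL = true) :
    ∀ (c : Fin t) (l : Fin r), ∃ (N : ℕ) (r' : Fin n →₀ ℕ),
      N • chartM n AL2 CL t c = ∑ j : Fin n, chartD n r CL t c l j • chartA n AL2 CL t c j + r' := by
  intro c l
  have hch := chartRec_mem ht c
  obtain ⟨-, -, hm, hlen, ha, hdl, hdlen⟩ := shapes_chart hsh hch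
  simp only [checkHunit, Bool.and_eq_true, Nat.beq_eq, List.all_eq_true] at h
  obtain ⟨hlenN, hall⟩ := h
  have hmem := mk_getL_mem_zip CL NuL ([], (0, 0), [], []) [] c.1 (by rw [ht]; exact c.2) (by rw [← hlenN, ht]; exact c.2)
  change (chartRec CL c.1, getL NuL c.1 []) ∈ CL.zip NuL at hmem
  have hc := hall _ hmem
  dsimp only at hc
  obtain ⟨hNlen, hcells⟩ := hc
  rw [forceL_eq, forceLL_eq, List.all_eq_true] at hcells
  have hdN := hcells _ (mk_getL_mem_zip (chartRec CL c.1).2.2.2 (getL NuL c.1 []) [] 0 l.1 (by rw [hdl]; exact l.2)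
    (by rw [hNlen]; exact l.2))
  dsimp only at hdN
  obtain ⟨-, hle⟩ := le_of_vleL _ _ hdN
  set N := getL (getL NuL c.1 []) l.1 0
  refine ⟨N, N • chartM n AL2 CL t c - ∑ j : Fin n, chartD n r CL t c l j • chartA n AL2 CL t c j, (add_tsub_cancel_of_le ?_).symm⟩
  intro j'
  have hj' := hle j'.1
  have hdlen' : (getL (chartRec CL c.1).2.2.2 l.1 []).length = n := hdlen _ (getL_mem _ _ _ (by rw [hdl]; exact l.2))
  have havlen : (List.map (fun k => get2 AL2 k) (chartRec CL c.1).2.2.1).length = n := by rw [List.length_map, hlen]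
  rw [getL_sumScaledL n _ _ j'.1 j'.2, getL_smulL, dotL_eq_sum n _ _ hdlen' (by rw [length_colL, havlen])] at hj'
  simp only [Finsupp.finsetSum_apply, Finsupp.smul_apply, smul_eq_mul, chartM, chartD, chartA, coe_expOf]
  refine le_of_eq_of_le ?_ hj'
  refine Finset.sum_congr rfl fun j _ => ?_
  show _ = vecOf n _ j * vecOf n (colL _ j'.1) j
  simp only [vecOf]
  rw [getL_colL, getL_map_of_lt (fun k => get2 AL2 k) _ j.1 (0, 0) [] (by rw [hlen]; exact j.2)]

/-- **(hprim)** a pure power of every variable is a generator. [folklore] -/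
theorem hprim_of_check (PJ : List (ℕ × ℕ)) (hsh : checkShapes n r AL2 RAYS CL = true) (h : checkHprim n AL2 PJ = true) :
    ∀ j ∈ (Finset.univ : Finset (Fin n)), ∃ N : ℕ, Finsupp.single j N ∈ genSet n AL2 := by
  intro j _
  simp only [checkHprim, Bool.and_eq_true, Nat.beq_eq, List.all_eq_true] at h
  obtain ⟨hPlen, hall⟩ := h
  have hjk := hall _ (mk_getL_mem_range_zip n PJ (0, 0) j.1 j.2 (by rw [hPlen]; exact j.2))
  obtain ⟨hip, hzero⟩ := hjk
  set l := get2 AL2 (getL PJ j.1 (0, 0)) with hl_def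
  have hllen : l.length = n := length_get2 hsh hip
  refine ⟨getL l j.1 0, ?_⟩
  have hsingle : Finsupp.single j (getL l j.1 0) = expOf n l := by
    ext i
    rw [Finsupp.single_apply, coe_expOf]
    show _ = getL l i.1 0
    by_cases hji : j = i
    · subst hji; rw [if_pos rfl]
    · rw [if_neg hji]
      have hix := hzero _ (mk_getL_mem_range_zip n l 0 i.1 i.2 (by rw [hllen]; exact i.2))
      simp only [Bool.or_eq_true, Nat.beq_eq] at hix
      rcases hix with hix | hix
      · exact absurd (Fin.ext hix).symm hji
      · exact hix.symm
  rw [hsingle]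
  exact expOf_mem_genSet (get2_mem_flatten hip)

/-- **(hAJ)** no generator is the zero exponent: each has a positive entry. [folklore] -/
theorem hAJ_of_check (hsh : checkShapes n r AL2 RAYS CL = true) (h : checkHAJ AL2 = true) :
    ∀ a ∈ genSet n AL2, ∃ j ∈ (Finset.univ : Finset (Fin n)), 0 < a j := by
  intro a ha
  obtain ⟨l, hl, rfl⟩ := exists_of_mem_genSet ha
  have hlen : l.length = n := shapes_AL2 hsh l hl
  obtain ⟨ch, hch, hlch⟩ := List.mem_flatten.mp hl
  simp only [checkHAJ, List.all_eq_true] at h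
  obtain ⟨x, hx, hx0⟩ := List.any_eq_true.mp (h ch hch l hlch)
  rw [Nat.blt_eq] at hx0
  obtain ⟨i, hi, hix⟩ := exists_getL_eq_of_mem l 0 hx
  refine ⟨⟨i, hlen ▸ hi⟩, Finset.mem_univ _, ?_⟩
  rw [coe_expOf]
  show 0 < getL l i 0
  rw [hix]
  exact hx0

end Binders2

end Summit.ResolutionOfSingularities.ResolutionOfSingularities.Theorems.FInjectiveMacaulayfication.FanCheckSound
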